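import Summits.CriticalPhenomena.PercolationContinuityZ3.Theorems.PercNearOneGluingNoHeavyConstsClusterSquareOuterplanar
import HarnessLib

/-!
# CSQ, DUU and TS on every weighted PARTIAL WHEEL (cycle plus a hub joined to any set of rim vertices), terminals on the rim

builds on p205010 (kernel theorem, internal audit signed; external expert review pending)

PAPER-2 track "percolation constants", part (ii), seat `prim-consts-1`, gen 19 (lane index
`run/shared/lean/prim/consts/CONSTANTS.md`, row A19; memo `FROM-prim-consts-1-g19-ROOT-CHOICE.md` §0(7)).
Support file for the crux `NoHeavyLowerTail` (stmt-CriticalPhenomena-4575; `--supports`).  Theorems only; no sorries.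

THE CLASS.  `H` on `Fin n` with a distinguished HUB `h`; every other vertex is a RIM vertex with a position `pos u : Fin m`
(`pos` injective on the rim; the hub's position is irrelevant); rim–rim edges join cyclically consecutive positions only (`(pos v - pos u).val = 1` or `(pos u - pos v).val = 1`);
hub–rim edges are arbitrary.  These are the wheels `W_N`, the fans, and every "partial wheel" (a cycle or a union of arcs plus a hub joined
to any subset) — planar graphs with the rim on the outer face; `W_N` (`N ≥ 4`) is NOT outerplanar, so `…ClusterSquareOuterplanar(Pos)`
does not apply.  THE RESULT: for terminals `a, b, c` on the rim, no cluster of `a` is doubly linked to `{b, c}` (`Consts.Wheel.unlinked`),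
hence CSQ, DUU, TS for every weight vector supported on `H` (`Consts.clusterSquare_le_sq_of_wheel`, `Consts.sq_real_split_le_of_wheel`,
`Consts.tripleSplit_of_wheel`).  Structural census (lane engine `eng/wheels.py`, `eng/apexface.py`): NDC holds at every rim root of every
partial wheel with `N ≤ 7` rim vertices (6 075 rooted cases) — this file proves it for all `N`.

THE PROOF.  Cut the rim open at `a` (`ρ u = (pos u - pos a).val`).  (i) A walk avoiding the hub and `a` moves by `±1` in `ρ` at every step,
so it visits every rim vertex whose position lies strictly between those of its endpoints (`Wheel.mem_support_of_between`).  (ii) If the hub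
is not in `K`, then `K` (rim-connected from `a`) is a cyclic interval around `a`: no vertex of `K` lies strictly between two rim vertices
outside `K` (`Wheel.not_between_of_mem`).  Given both linkages `P₁: y→b, P₂: y'→c` and `Q₁: y→c, Q₂: y'→b` (walks avoiding `K`, disjoint
supports within each pair): if the hub is in `K` all four walks are interval walks and the four pairs `{y,b}, {y',c}, {y,c}, {y',b}` would all be
adjacent among four points of a line — impossible; if not, at most one walk of each pair uses the hub, `y, y'` have `K`-neighbours at
`ρ ± 1`, and (ii) forces `y, y'` (when on the rim) to be the extreme points, after which the interval walks of the two linkages order `b, c`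
oppositely.  All case distinctions are discharged by `omega` on the positions.
References: N. Gladkov, arXiv:2408.08457v2 (2024), Thm. 4.3, Def. 4.2, Lemma 3.1, Thm. 5.2 (two-copy vdBK behind `…ClusterSquareUnlinked`).
-/

noncomputable section

open Classical

namespace Summit.CriticalPhenomena.PercolationContinuityZ3.Theorems

open MeasureTheory Finset Literature.Probability.LatticeModels Literature.Probability.Percolation

namespace Consts

namespace Wheel

variable {n m : ℕ} {H : SimpleGraph (Fin n)} {h : Fin n} {pos : Fin n → Fin m}

/-- One rim step changes the cut-open position by `±1` (or wraps through the cut vertex `a`). [folklore] -/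
theorem step (hrim : ∀ u v, u ≠ h → v ≠ h → H.Adj u v → (pos v - pos u).val = 1 ∨ (pos u - pos v).val = 1)
    (a : Fin n) {u w : Fin n} (hu : u ≠ h) (hw : w ≠ h) (huw : H.Adj u w) :
    (pos w - pos a).val = (pos u - pos a).val + 1 ∨ (pos u - pos a).val = (pos w - pos a).val + 1 ∨
      ((pos u - pos a).val + 1 = m ∧ (pos w - pos a).val = 0) ∨ ((pos w - pos a).val + 1 = m ∧ (pos u - pos a).val = 0) := by
  have hpu := (pos u).isLt; have hpw := (pos w).isLt; have hpa := (pos a).isLt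
  rcases hrim u w hu hw huw with h1 | h1 <;>
  · simp only [NonCrossing.val_sub_eq] at h1 ⊢
    split_ifs at h1 ⊢ <;> omega

/-- (i) INTERVAL WALKS: a walk avoiding the hub and the cut vertex `a` contains every rim vertex whose position lies strictly between the
positions of its endpoints. [folklore] -/
theorem mem_support_of_between (hpos : ∀ u v, u ≠ h → v ≠ h → pos u = pos v → u = v)
    (hrim : ∀ u v, u ≠ h → v ≠ h → H.Adj u v → (pos v - pos u).val = 1 ∨ (pos u - pos v).val = 1)
    {a : Fin n} (ha : a ≠ h) {u v : Fin n} (W : H.Walk u v) (hWh : ∀ x ∈ W.support, x ≠ h) (hWa : ∀ x ∈ W.support, x ≠ a)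
    (z : Fin n) (hzh : z ≠ h)
    (hz : ((pos u - pos a).val < (pos z - pos a).val ∧ (pos z - pos a).val < (pos v - pos a).val) ∨
      ((pos v - pos a).val < (pos z - pos a).val ∧ (pos z - pos a).val < (pos u - pos a).val)) :
    z ∈ W.support := by
  induction W with
  | nil => omega
  | @cons u w v huw W ih =>
    have hu : u ≠ h := hWh u (SimpleGraph.Walk.start_mem_support _)
    have hw : w ≠ h := hWh w (by simp)
    have hua : u ≠ a := hWa u (SimpleGraph.Walk.start_mem_support _)
    have hwa : w ≠ a := hWa w (by simp)
    have hu0 : (pos u - pos a).val ≠ 0 := fun h0 =>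
      hua (hpos u a hu ha (NonCrossing.rot_injective (pos a) (h0.trans (NonCrossing.rot_self _).symm)))
    have hw0 : (pos w - pos a).val ≠ 0 := fun h0 =>
      hwa (hpos w a hw ha (NonCrossing.rot_injective (pos a) (h0.trans (NonCrossing.rot_self _).symm)))
    have hst := step hrim a hu hw huw
    by_cases hz' : ((pos w - pos a).val < (pos z - pos a).val ∧ (pos z - pos a).val < (pos v - pos a).val) ∨
        ((pos v - pos a).val < (pos z - pos a).val ∧ (pos z - pos a).val < (pos w - pos a).val)
    · exact List.mem_of_mem_tail (by
        rw [SimpleGraph.Walk.support_cons, List.tail_cons]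
        exact ih (fun x hx => hWh x (by simp [hx])) (fun x hx => hWa x (by simp [hx])) hz')
    · have hzw : (pos z - pos a).val = (pos w - pos a).val := by omega
      have : z = w := hpos z w hzh hw (NonCrossing.rot_injective (pos a) hzw)
      subst this
      simp

/-- Invariance of "not strictly between `z₁` and `z₂`" along a hub-free walk inside `K` (`z₁, z₂ ∉ K`). [folklore] -/
private theorem not_between_walk (hpos : ∀ u v, u ≠ h → v ≠ h → pos u = pos v → u = v)
    (hrim : ∀ u v, u ≠ h → v ≠ h → H.Adj u v → (pos v - pos u).val = 1 ∨ (pos u - pos v).val = 1)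
    {K : Set (Fin n)} (a : Fin n) (hhK : h ∉ K) {z₁ z₂ : Fin n} (hz₁ : z₁ ∉ K) (hz₂ : z₂ ∉ K) (hz₁h : z₁ ≠ h) (hz₂h : z₂ ≠ h)
    {u k : Fin n} (W : H.Walk u k) (hW : ∀ v ∈ W.support, v ∈ K)
    (hu : ¬ ((pos z₁ - pos a).val < (pos u - pos a).val ∧ (pos u - pos a).val < (pos z₂ - pos a).val)) :
    ¬ ((pos z₁ - pos a).val < (pos k - pos a).val ∧ (pos k - pos a).val < (pos z₂ - pos a).val) := by
  induction W with
  | nil => exact hu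
  | @cons u w v huw W ih =>
    have huK : u ∈ K := hW u (SimpleGraph.Walk.start_mem_support _)
    have hwK : w ∈ K := hW w (by simp)
    have huh : u ≠ h := fun e => hhK (e ▸ huK)
    have hwh : w ≠ h := fun e => hhK (e ▸ hwK)
    have hz₂' := (pos z₂ - pos a).isLt
    have hw1 : (pos w - pos a).val ≠ (pos z₁ - pos a).val := fun e =>
      hz₁ (hpos w z₁ hwh hz₁h (NonCrossing.rot_injective (pos a) e) ▸ hwK)
    have hw2 : (pos w - pos a).val ≠ (pos z₂ - pos a).val := fun e =>
      hz₂ (hpos w z₂ hwh hz₂h (NonCrossing.rot_injective (pos a) e) ▸ hwK)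
    have hu1 : (pos u - pos a).val ≠ (pos z₁ - pos a).val := fun e =>
      hz₁ (hpos u z₁ huh hz₁h (NonCrossing.rot_injective (pos a) e) ▸ huK)
    have hu2 : (pos u - pos a).val ≠ (pos z₂ - pos a).val := fun e =>
      hz₂ (hpos u z₂ huh hz₂h (NonCrossing.rot_injective (pos a) e) ▸ huK)
    have hst := step hrim a huh hwh huw
    refine ih (fun x hx => hW x (List.mem_of_mem_tail hx)) ?_
    omega

/-- (ii) If the hub is not in `K` and `K` is `H`-connected from `a`, then no vertex of `K` lies strictly between (in cut-open position)
two vertices outside `K`. [folklore] -/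
theorem not_between_of_mem (hpos : ∀ u v, u ≠ h → v ≠ h → pos u = pos v → u = v)
    (hrim : ∀ u v, u ≠ h → v ≠ h → H.Adj u v → (pos v - pos u).val = 1 ∨ (pos u - pos v).val = 1)
    {K : Set (Fin n)} {a : Fin n} (hhK : h ∉ K) (hKw : ∀ s ∈ K, ∃ W : H.Walk a s, ∀ v ∈ W.support, v ∈ K)
    {z₁ z₂ k : Fin n} (hz₁ : z₁ ∉ K) (hz₂ : z₂ ∉ K) (hz₁h : z₁ ≠ h) (hz₂h : z₂ ≠ h) (hk : k ∈ K) :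
    ¬ ((pos z₁ - pos a).val < (pos k - pos a).val ∧ (pos k - pos a).val < (pos z₂ - pos a).val) := by
  obtain ⟨W, hW⟩ := hKw k hk
  refine not_between_walk hpos hrim a hhK hz₁ hz₂ hz₁h hz₂h W hW ?_
  rw [NonCrossing.rot_self]
  omega

/-! ### The order-theoretic endgames (plain arithmetic on the cut-open positions) -/

/-- Case A (hub in `K`): four points of a line cannot have all of `{y,b}, {y',c}, {y,c}, {y',b}` adjacent. [folklore] -/
private theorem arith_A {Y Y' B C : ℕ} (dbc : B ≠ C) (dyb : Y ≠ B) (dyc : Y ≠ C) (dyy' : Y ≠ Y')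
    (f2 : ¬ ((Y < C ∧ C < B) ∨ (B < C ∧ C < Y))) (f6 : ¬ ((Y < B ∧ B < C) ∨ (C < B ∧ B < Y)))
    (f3 : ¬ ((Y' < Y ∧ Y < C) ∨ (C < Y ∧ Y < Y'))) (f7 : ¬ ((Y' < Y ∧ Y < B) ∨ (B < Y ∧ Y < Y'))) : False := by
  omega

/-- A rim point with a `K`-neighbour at distance one that is never strictly between two of the four non-`K` points is an extreme point.
[folklore] -/
private theorem arith_ext {Y Y' B C K m : ℕ} (ly' : Y' < m) (lb : B < m) (lc : C < m)
    (dyb : Y ≠ B) (dyc : Y ≠ C) (dyy' : Y ≠ Y') (dky : K ≠ Y) (dky' : K ≠ Y') (dkb : K ≠ B) (dkc : K ≠ C)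
    (s : Y = K + 1 ∨ K = Y + 1 ∨ (K + 1 = m ∧ Y = 0) ∨ (Y + 1 = m ∧ K = 0))
    (n1 : ¬ (Y < K ∧ K < Y')) (n2 : ¬ (Y' < K ∧ K < Y)) (n3 : ¬ (Y < K ∧ K < B)) (n4 : ¬ (B < K ∧ K < Y))
    (n5 : ¬ (Y < K ∧ K < C)) (n6 : ¬ (C < K ∧ K < Y)) :
    (Y < Y' ∧ Y < B ∧ Y < C) ∨ (Y' < Y ∧ B < Y ∧ C < Y) := by
  omega

/-- Case B1/B2 (one clash vertex is the hub): the other clash vertex would be strictly between `b` and `c` and have its `K`-neighbour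
inside an interval walk. [folklore] -/
private theorem arith_B1 {Y' B C K' m : ℕ} (lb : B < m) (lc : C < m)
    (dbc : B ≠ C) (dy'b : Y' ≠ B) (dy'c : Y' ≠ C) (dk'b : K' ≠ B) (dk'c : K' ≠ C) (dk'y' : K' ≠ Y')
    (s' : Y' = K' + 1 ∨ K' = Y' + 1 ∨ (K' + 1 = m ∧ Y' = 0) ∨ (Y' + 1 = m ∧ K' = 0))
    (f4 : ¬ ((Y' < B ∧ B < C) ∨ (C < B ∧ B < Y'))) (f8 : ¬ ((Y' < C ∧ C < B) ∨ (B < C ∧ C < Y')))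
    (n3 : ¬ (Y' < K' ∧ K' < B)) (n4 : ¬ (B < K' ∧ K' < Y')) (n5 : ¬ (Y' < K' ∧ K' < C)) (n6 : ¬ (C < K' ∧ K' < Y')) :
    False := by
  omega

/-- Case B3, hub-free walks `P₁, Q₁`. [folklore] -/
private theorem arith_B3a {Y Y' B C : ℕ} (dbc : B ≠ C) (ey : (Y < Y' ∧ Y < B ∧ Y < C) ∨ (Y' < Y ∧ B < Y ∧ C < Y))
    (f2 : ¬ ((Y < C ∧ C < B) ∨ (B < C ∧ C < Y))) (f6 : ¬ ((Y < B ∧ B < C) ∨ (C < B ∧ B < Y))) : False := by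
  omega

/-- Case B3, hub-free walks `P₁, Q₂`. [folklore] -/
private theorem arith_B3b {Y Y' B C : ℕ} (dbc : B ≠ C) (ey : (Y < Y' ∧ Y < B ∧ Y < C) ∨ (Y' < Y ∧ B < Y ∧ C < Y))
    (ey' : (Y' < Y ∧ Y' < B ∧ Y' < C) ∨ (Y < Y' ∧ B < Y' ∧ C < Y'))
    (f2 : ¬ ((Y < C ∧ C < B) ∨ (B < C ∧ C < Y))) (f8 : ¬ ((Y' < C ∧ C < B) ∨ (B < C ∧ C < Y'))) : False := by
  omega

/-- Case B3, hub-free walks `P₂, Q₁`. [folklore] -/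
private theorem arith_B3c {Y Y' B C : ℕ} (dbc : B ≠ C) (ey : (Y < Y' ∧ Y < B ∧ Y < C) ∨ (Y' < Y ∧ B < Y ∧ C < Y))
    (ey' : (Y' < Y ∧ Y' < B ∧ Y' < C) ∨ (Y < Y' ∧ B < Y' ∧ C < Y'))
    (f4 : ¬ ((Y' < B ∧ B < C) ∨ (C < B ∧ B < Y'))) (f6 : ¬ ((Y < B ∧ B < C) ∨ (C < B ∧ B < Y))) : False := by
  omega

/-- Case B3, hub-free walks `P₂, Q₂`. [folklore] -/
private theorem arith_B3d {Y' B C : ℕ} (dbc : B ≠ C) (ey' : ∃ Y : ℕ, (Y' < Y ∧ Y' < B ∧ Y' < C) ∨ (Y < Y' ∧ B < Y' ∧ C < Y'))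
    (f4 : ¬ ((Y' < B ∧ B < C) ∨ (C < B ∧ B < Y'))) (f8 : ¬ ((Y' < C ∧ C < B) ∨ (B < C ∧ C < Y'))) : False := by
  obtain ⟨Y, ey'⟩ := ey'
  omega

/-! ### No double linkage in a partial wheel -/

/-- **In a partial wheel no cluster of a rim vertex `a` is doubly linked to two other rim vertices `{b, c}`**: the hypothesis `hK` of
`Consts.clusterSquare_le_sq_of_unlinked`.  [folklore: planar graphs with the terminals on a common face; cf. Gladkov2024, Thm. 6.1] -/
theorem unlinked (H : SimpleGraph (Fin n)) (h : Fin n) (pos : Fin n → Fin m) (hpos : ∀ u v, u ≠ h → v ≠ h → pos u = pos v → u = v)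
    (hrim : ∀ u v, u ≠ h → v ≠ h → H.Adj u v → (pos v - pos u).val = 1 ∨ (pos u - pos v).val = 1)
    (a b c : Fin n) (ha : a ≠ h) (hb : b ≠ h) (hc : c ≠ h) :
    ∀ (K : Set (Fin n)) (y y' : Fin n), a ∈ K → b ∉ K → c ∉ K →
      (∀ T : Set (Fin n), a ∈ T → (∀ u x, u ∈ T → H.Adj u x → x ∈ K → x ∈ T) → K ⊆ T) →
      y ∉ K → y' ∉ K → (∃ k, k ∈ K ∧ H.Adj k y) → (∃ k, k ∈ K ∧ H.Adj k y') →
      y ≠ a → y ≠ b → y ≠ c → y' ≠ a → y' ≠ b → y' ≠ c → y ≠ y' →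
      (∀ (P₁ : H.Walk y b) (P₂ : H.Walk y' c), (∀ x ∈ P₁.support, x ∉ K) → (∀ x ∈ P₂.support, x ∉ K) →
          ∃ x, x ∈ P₁.support ∧ x ∈ P₂.support) ∨
      (∀ (Q₁ : H.Walk y c) (Q₂ : H.Walk y' b), (∀ x ∈ Q₁.support, x ∉ K) → (∀ x ∈ Q₂.support, x ∉ K) →
          ∃ x, x ∈ Q₁.support ∧ x ∈ Q₂.support) := by
  intro K y y' haK hbK hcK hcl hyK hy'K hky hk'y' hya hyb hyc hy'a hy'b hy'c hyy'
  obtain ⟨k, hkK, hky⟩ := hky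
  obtain ⟨k', hk'K, hk'y'⟩ := hk'y'
  by_contra hcon
  push Not at hcon
  obtain ⟨⟨P₁, P₂, hP₁, hP₂, hPd⟩, ⟨Q₁, Q₂, hQ₁, hQ₂, hQd⟩⟩ := hcon
  have hKw := NonCrossing.walks_of_closure haK hcl
  -- memberships
  have hyP₁ : y ∈ P₁.support := P₁.start_mem_support
  have hbP₁ : b ∈ P₁.support := P₁.end_mem_support
  have hy'P₂ : y' ∈ P₂.support := P₂.start_mem_support
  have hcP₂ : c ∈ P₂.support := P₂.end_mem_support
  have hyQ₁ : y ∈ Q₁.support := Q₁.start_mem_support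
  have hcQ₁ : c ∈ Q₁.support := Q₁.end_mem_support
  have hy'Q₂ : y' ∈ Q₂.support := Q₂.start_mem_support
  have hbQ₂ : b ∈ Q₂.support := Q₂.end_mem_support
  have hbc : b ≠ c := fun e => hPd b hbP₁ (e ▸ hcP₂)
  have hkb : k ≠ b := fun e => hbK (e ▸ hkK)
  have hkc : k ≠ c := fun e => hcK (e ▸ hkK)
  have hky_ne : k ≠ y := fun e => hyK (e ▸ hkK)
  have hky'_ne : k ≠ y' := fun e => hy'K (e ▸ hkK)
  have hk'b : k' ≠ b := fun e => hbK (e ▸ hk'K)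
  have hk'c : k' ≠ c := fun e => hcK (e ▸ hk'K)
  have hk'y_ne : k' ≠ y := fun e => hyK (e ▸ hk'K)
  have hk'y'_ne : k' ≠ y' := fun e => hy'K (e ▸ hk'K)
  -- walks avoiding `K` avoid `a`
  have aP₁ : ∀ x ∈ P₁.support, x ≠ a := fun x hx e => hP₁ x hx (e ▸ haK)
  have aP₂ : ∀ x ∈ P₂.support, x ≠ a := fun x hx e => hP₂ x hx (e ▸ haK)
  have aQ₁ : ∀ x ∈ Q₁.support, x ≠ a := fun x hx e => hQ₁ x hx (e ▸ haK)
  have aQ₂ : ∀ x ∈ Q₂.support, x ≠ a := fun x hx e => hQ₂ x hx (e ▸ haK)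
  -- positions cut open at `a`: distinct rim vertices have distinct positions
  have D : ∀ {u v : Fin n}, u ≠ h → v ≠ h → u ≠ v → (pos u - pos a).val ≠ (pos v - pos a).val :=
    fun hu hv huv e => huv (hpos _ _ hu hv (NonCrossing.rot_injective (pos a) e))
  have lb := (pos b - pos a).isLt; have lc := (pos c - pos a).isLt
  have ly := (pos y - pos a).isLt; have ly' := (pos y' - pos a).isLt
  -- interval-walk facts for each of the four walks, conditional on avoiding the hub
  have IP₁ : (∀ x ∈ P₁.support, x ≠ h) → ∀ z, z ≠ h → z ∉ P₁.support →
      ¬ (((pos y - pos a).val < (pos z - pos a).val ∧ (pos z - pos a).val < (pos b - pos a).val) ∨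
        ((pos b - pos a).val < (pos z - pos a).val ∧ (pos z - pos a).val < (pos y - pos a).val)) :=
    fun hh z hzh hz hb' => hz (mem_support_of_between hpos hrim ha P₁ hh aP₁ z hzh hb')
  have IP₂ : (∀ x ∈ P₂.support, x ≠ h) → ∀ z, z ≠ h → z ∉ P₂.support →
      ¬ (((pos y' - pos a).val < (pos z - pos a).val ∧ (pos z - pos a).val < (pos c - pos a).val) ∨
        ((pos c - pos a).val < (pos z - pos a).val ∧ (pos z - pos a).val < (pos y' - pos a).val)) :=
    fun hh z hzh hz hb' => hz (mem_support_of_between hpos hrim ha P₂ hh aP₂ z hzh hb')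
  have IQ₁ : (∀ x ∈ Q₁.support, x ≠ h) → ∀ z, z ≠ h → z ∉ Q₁.support →
      ¬ (((pos y - pos a).val < (pos z - pos a).val ∧ (pos z - pos a).val < (pos c - pos a).val) ∨
        ((pos c - pos a).val < (pos z - pos a).val ∧ (pos z - pos a).val < (pos y - pos a).val)) :=
    fun hh z hzh hz hb' => hz (mem_support_of_between hpos hrim ha Q₁ hh aQ₁ z hzh hb')
  have IQ₂ : (∀ x ∈ Q₂.support, x ≠ h) → ∀ z, z ≠ h → z ∉ Q₂.support →
      ¬ (((pos y' - pos a).val < (pos z - pos a).val ∧ (pos z - pos a).val < (pos b - pos a).val) ∨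
        ((pos b - pos a).val < (pos z - pos a).val ∧ (pos z - pos a).val < (pos y' - pos a).val)) :=
    fun hh z hzh hz hb' => hz (mem_support_of_between hpos hrim ha Q₂ hh aQ₂ z hzh hb')
  -- non-memberships from disjointness
  have y'P₁ : y' ∉ P₁.support := fun hx => hPd _ hx hy'P₂
  have cP₁ : c ∉ P₁.support := fun hx => hPd _ hx hcP₂
  have yP₂ : y ∉ P₂.support := fun hx => hPd _ hyP₁ hx
  have bP₂ : b ∉ P₂.support := fun hx => hPd _ hbP₁ hx
  have y'Q₁ : y' ∉ Q₁.support := fun hx => hQd _ hx hy'Q₂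
  have bQ₁ : b ∉ Q₁.support := fun hx => hQd _ hx hbQ₂
  have yQ₂ : y ∉ Q₂.support := fun hx => hQd _ hyQ₁ hx
  have cQ₂ : c ∉ Q₂.support := fun hx => hQd _ hcQ₁ hx
  by_cases hhK : h ∈ K
  · -- CASE A: the hub is in `K`: all four walks are interval walks
    have hyh : y ≠ h := fun e => hyK (e ▸ hhK)
    have hy'h : y' ≠ h := fun e => hy'K (e ▸ hhK)
    have hP₁h : ∀ x ∈ P₁.support, x ≠ h := fun x hx e => hP₁ x hx (e ▸ hhK)
    have hP₂h : ∀ x ∈ P₂.support, x ≠ h := fun x hx e => hP₂ x hx (e ▸ hhK)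
    have hQ₁h : ∀ x ∈ Q₁.support, x ≠ h := fun x hx e => hQ₁ x hx (e ▸ hhK)
    have hQ₂h : ∀ x ∈ Q₂.support, x ≠ h := fun x hx e => hQ₂ x hx (e ▸ hhK)
    exact arith_A (D hb hc hbc) (D hyh hb hyb) (D hyh hc hyc) (D hyh hy'h hyy')
      (IP₁ hP₁h c hc cP₁) (IQ₁ hQ₁h b hb bQ₁) (IP₂ hP₂h y hyh yP₂) (IQ₂ hQ₂h y hyh yQ₂)
  · -- CASE B: the hub is not in `K`
    have hkh : k ≠ h := fun e => hhK (e ▸ hkK)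
    have hk'h : k' ≠ h := fun e => hhK (e ▸ hk'K)
    -- at most one walk of each linkage meets the hub
    have hPh : (∀ x ∈ P₁.support, x ≠ h) ∨ (∀ x ∈ P₂.support, x ≠ h) := by
      by_contra hno
      push Not at hno
      obtain ⟨⟨x, hx, rfl⟩, ⟨x', hx', hxx'⟩⟩ := hno
      exact hPd x hx (hxx' ▸ hx')
    have hQh : (∀ x ∈ Q₁.support, x ≠ h) ∨ (∀ x ∈ Q₂.support, x ≠ h) := by
      by_contra hno
      push Not at hno
      obtain ⟨⟨x, hx, rfl⟩, ⟨x', hx', hxx'⟩⟩ := hno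
      exact hQd x hx (hxx' ▸ hx')
    by_cases hyh : y = h
    · -- `y` is the hub: `P₂` and `Q₂` avoid it
      subst hyh
      have hP₂h : ∀ x ∈ P₂.support, x ≠ y := fun x hx e => hPd _ hyP₁ (e ▸ hx)
      have hQ₂h : ∀ x ∈ Q₂.support, x ≠ y := fun x hx e => hQd _ hyQ₁ (e ▸ hx)
      have hy'h : y' ≠ y := fun e => hyy' e.symm
      exact arith_B1 lb lc (D hb hc hbc) (D hy'h hb hy'b) (D hy'h hc hy'c) (D hk'h hb hk'b) (D hk'h hc hk'c)
        (D hk'h hy'h hk'y'_ne) (step hrim a hk'h hy'h hk'y')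
        (IP₂ hP₂h b hb bP₂) (IQ₂ hQ₂h c hc cQ₂)
        (not_between_of_mem hpos hrim hhK hKw hy'K hbK hy'h hb hk'K) (not_between_of_mem hpos hrim hhK hKw hbK hy'K hb hy'h hk'K)
        (not_between_of_mem hpos hrim hhK hKw hy'K hcK hy'h hc hk'K) (not_between_of_mem hpos hrim hhK hKw hcK hy'K hc hy'h hk'K)
    by_cases hy'h : y' = h
    · -- `y'` is the hub: `P₁` and `Q₁` avoid it
      subst hy'h
      have hP₁h : ∀ x ∈ P₁.support, x ≠ y' := fun x hx e => hPd _ (e ▸ hx) hy'P₂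
      have hQ₁h : ∀ x ∈ Q₁.support, x ≠ y' := fun x hx e => hQd _ (e ▸ hx) hy'Q₂
      exact arith_B1 lc lb (D hc hb (Ne.symm hbc)) (D hyh hc hyc) (D hyh hb hyb) (D hkh hc hkc) (D hkh hb hkb)
        (D hkh hyh hky_ne) (step hrim a hkh hyh hky)
        (IP₁ hP₁h c hc cP₁) (IQ₁ hQ₁h b hb bQ₁)
        (not_between_of_mem hpos hrim hhK hKw hyK hcK hyh hc hkK) (not_between_of_mem hpos hrim hhK hKw hcK hyK hc hyh hkK)
        (not_between_of_mem hpos hrim hhK hKw hyK hbK hyh hb hkK) (not_between_of_mem hpos hrim hhK hKw hbK hyK hb hyh hkK)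
    -- both `y, y'` on the rim: each is an extreme point of `{y, y', b, c}` (its `K`-neighbour is at distance one)
    have ey := arith_ext ly' lb lc (D hyh hb hyb) (D hyh hc hyc) (D hyh hy'h hyy') (D hkh hyh hky_ne) (D hkh hy'h hky'_ne)
      (D hkh hb hkb) (D hkh hc hkc) (step hrim a hkh hyh hky)
      (not_between_of_mem hpos hrim hhK hKw hyK hy'K hyh hy'h hkK) (not_between_of_mem hpos hrim hhK hKw hy'K hyK hy'h hyh hkK)
      (not_between_of_mem hpos hrim hhK hKw hyK hbK hyh hb hkK) (not_between_of_mem hpos hrim hhK hKw hbK hyK hb hyh hkK)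
      (not_between_of_mem hpos hrim hhK hKw hyK hcK hyh hc hkK) (not_between_of_mem hpos hrim hhK hKw hcK hyK hc hyh hkK)
    have ey' := arith_ext ly lb lc (D hy'h hb hy'b) (D hy'h hc hy'c) (D hy'h hyh (Ne.symm hyy')) (D hk'h hy'h hk'y'_ne)
      (D hk'h hyh hk'y_ne) (D hk'h hb hk'b) (D hk'h hc hk'c) (step hrim a hk'h hy'h hk'y')
      (not_between_of_mem hpos hrim hhK hKw hy'K hyK hy'h hyh hk'K) (not_between_of_mem hpos hrim hhK hKw hyK hy'K hyh hy'h hk'K)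
      (not_between_of_mem hpos hrim hhK hKw hy'K hbK hy'h hb hk'K) (not_between_of_mem hpos hrim hhK hKw hbK hy'K hb hy'h hk'K)
      (not_between_of_mem hpos hrim hhK hKw hy'K hcK hy'h hc hk'K) (not_between_of_mem hpos hrim hhK hKw hcK hy'K hc hy'h hk'K)
    -- the hub-free walk of each linkage orders `b, c`; the two linkages order them oppositely
    rcases hPh with hP₁h | hP₂h <;> rcases hQh with hQ₁h | hQ₂h
    · exact arith_B3a (D hb hc hbc) ey (IP₁ hP₁h c hc cP₁) (IQ₁ hQ₁h b hb bQ₁)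
    · exact arith_B3b (D hb hc hbc) ey ey' (IP₁ hP₁h c hc cP₁) (IQ₂ hQ₂h c hc cQ₂)
    · exact arith_B3c (D hb hc hbc) ey ey' (IP₂ hP₂h b hb bP₂) (IQ₁ hQ₁h b hb bQ₁)
    · exact arith_B3d (D hb hc hbc) ⟨_, ey'⟩ (IP₂ hP₂h b hb bP₂) (IQ₂ hQ₂h c hc cQ₂)

end Wheel

/-! ### CSQ, DUU, TS on partial wheels -/

section Fin

variable {n m : ℕ} (w : Sym2 (Fin n) → unitInterval) (a b c : Fin n) (H : SimpleGraph (Fin n)) (h : Fin n)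
  (pos : Fin n → Fin m)

/-- **CSQ on every weighted partial wheel, rim terminals.**  `H`: hub `h`, injective rim positions `pos`, rim–rim edges only between
cyclically consecutive positions, hub–rim edges arbitrary; positive pairs of `w` inside `H`; `a, b, c ≠ h`.  Then
`clusterSquare w a b c ≤ μ(b ↮ c)²`. [cite: Gladkov2024, Thm. 4.3, Def. 4.2, Lemma 3.1, Thm. 5.2] -/
theorem clusterSquare_le_sq_of_wheel (hH : ∀ u v, u ≠ v → (0 : ℝ) < w s(u, v) → H.Adj u v)
    (hpos : ∀ u v, u ≠ h → v ≠ h → pos u = pos v → u = v)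
    (hrim : ∀ u v, u ≠ h → v ≠ h → H.Adj u v → (pos v - pos u).val = 1 ∨ (pos u - pos v).val = 1)
    (ha : a ≠ h) (hb : b ≠ h) (hc : c ≠ h) :
    clusterSquare w a b c ≤ (prodBernoulli w).real (openConn b c)ᶜ ^ 2 :=
  clusterSquare_le_sq_of_unlinked w a b c H hH (Wheel.unlinked H h pos hpos hrim a b c ha hb hc)

/-- **DUU on every weighted partial wheel, rim terminals** (root `a`):
`μ(a↮b, a↮c, b↮c)² ≤ μ(a↮b, a↮c) · μ(b↮c)²`. [cite: Gladkov2024, Thm. 5.2 and Thm. 4.3] -/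
theorem sq_real_split_le_of_wheel (hH : ∀ u v, u ≠ v → (0 : ℝ) < w s(u, v) → H.Adj u v)
    (hpos : ∀ u v, u ≠ h → v ≠ h → pos u = pos v → u = v)
    (hrim : ∀ u v, u ≠ h → v ≠ h → H.Adj u v → (pos v - pos u).val = 1 ∨ (pos u - pos v).val = 1)
    (ha : a ≠ h) (hb : b ≠ h) (hc : c ≠ h) :
    (prodBernoulli w).real ((openConn a b)ᶜ ∩ (openConn a c)ᶜ ∩ (openConn b c)ᶜ) ^ 2 ≤
      (prodBernoulli w).real ((openConn a b)ᶜ ∩ (openConn a c)ᶜ) * (prodBernoulli w).real (openConn b c)ᶜ ^ 2 :=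
  sq_real_split_le_of_unlinked w a b c H hH (Wheel.unlinked H h pos hpos hrim a b c ha hb hc)

/-- **TS on every weighted partial wheel, rim terminals**: `μ(a↮b, a↮c, b↮c)² ≤ μ(a↮b) · μ(a↮c) · μ(b↮c)` — in particular on every
weighted wheel `W_N` and every fan, for all triples of rim vertices. [cite: Gladkov2024, Thm. 5.2, Cor. 5.3 (pattern) and Thm. 4.3] -/
theorem tripleSplit_of_wheel (hH : ∀ u v, u ≠ v → (0 : ℝ) < w s(u, v) → H.Adj u v)
    (hpos : ∀ u v, u ≠ h → v ≠ h → pos u = pos v → u = v)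
    (hrim : ∀ u v, u ≠ h → v ≠ h → H.Adj u v → (pos v - pos u).val = 1 ∨ (pos u - pos v).val = 1)
    (ha : a ≠ h) (hb : b ≠ h) (hc : c ≠ h) :
    (prodBernoulli w).real ((openConn a b)ᶜ ∩ (openConn a c)ᶜ ∩ (openConn b c)ᶜ) ^ 2 ≤
      (prodBernoulli w).real (openConn a b)ᶜ * (prodBernoulli w).real (openConn a c)ᶜ *
        (prodBernoulli w).real (openConn b c)ᶜ :=
  tripleSplit_of_unlinked w a b c H hH (Wheel.unlinked H h pos hpos hrim a b c ha hb hc)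


/-- **TS on the (partial) wheel, concretely.**  Vertices `Fin (N+1)`, hub `Fin.last N`, rim vertices `i.castSucc` (`i : Fin N`); ANY
weight vector whose positive rim–rim pairs join cyclically consecutive rim vertices (`(j - i).val = 1` or `(i - j).val = 1` in `Fin N`),
hub pairs arbitrary — every weighted wheel `W_N`, fan and partial wheel.  Then TS holds for every three rim vertices.
[cite: Gladkov2024, Thm. 5.2, Cor. 5.3 (pattern) and Thm. 4.3] -/
theorem tripleSplit_wheel (N : ℕ) (w : Sym2 (Fin (N + 1)) → unitInterval)
    (hw : ∀ i j : Fin N, i ≠ j → (0 : ℝ) < w s(i.castSucc, j.castSucc) → (j - i).val = 1 ∨ (i - j).val = 1)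
    (a b c : Fin N) :
    (prodBernoulli w).real ((openConn a.castSucc b.castSucc)ᶜ ∩ (openConn a.castSucc c.castSucc)ᶜ ∩
        (openConn b.castSucc c.castSucc)ᶜ) ^ 2 ≤
      (prodBernoulli w).real (openConn a.castSucc b.castSucc)ᶜ * (prodBernoulli w).real (openConn a.castSucc c.castSucc)ᶜ *
        (prodBernoulli w).real (openConn b.castSucc c.castSucc)ᶜ := by
  have hH : ∀ u v : Fin (N + 1), u ≠ v → (0 : ℝ) < w s(u, v) →
      (SimpleGraph.fromRel fun u v : Fin (N + 1) => (0 : ℝ) < w s(u, v)).Adj u v := fun u v huv h => by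
    rw [SimpleGraph.fromRel_adj]; exact ⟨huv, Or.inl h⟩
  refine tripleSplit_of_wheel w a.castSucc b.castSucc c.castSucc
    (SimpleGraph.fromRel fun u v : Fin (N + 1) => (0 : ℝ) < w s(u, v)) (Fin.last N)
    (fun u => if hu : u = Fin.last N then a else u.castPred hu) hH ?_ ?_
    (Fin.castSucc_lt_last a).ne (Fin.castSucc_lt_last b).ne (Fin.castSucc_lt_last c).ne
  · intro u v hu hv huv
    simp only [hu, hv, dite_false] at huv
    exact Fin.castPred_inj.1 huv
  · intro u v hu hv hadj
    rw [SimpleGraph.fromRel_adj] at hadj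
    obtain ⟨hne, hp⟩ := hadj
    have hp' : (0 : ℝ) < w s(u, v) := by
      rcases hp with h | h
      · exact h
      · rwa [Sym2.eq_swap]
    obtain ⟨i, rfl⟩ := Fin.exists_castSucc_eq.2 hu
    obtain ⟨j, rfl⟩ := Fin.exists_castSucc_eq.2 hv
    have hij : i ≠ j := fun e => hne (e ▸ rfl)
    simp only [hu, hv, dite_false, Fin.castPred_castSucc]
    exact hw i j hij hp'

end Fin

end Consts

end Summit.CriticalPhenomena.PercolationContinuityZ3.Theorems
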